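import Literature.NumberTheory.LFunctions.ConreyIwaniec2002SpacingMechanism
import Mathlib.Algebra.Order.Chebyshev
import HarnessLib

/-!
# Conrey–Iwaniec (2002), §9: the dyadic union behind Proposition 9.2

Conrey–Iwaniec, *Spacing of zeros of Hecke L-functions and the class number problem*, Acta Arith.
103 (2002), §9, p. 20 [held text `paper:arxiv-math_0111012`, p0020:L78–84]: "Finally, we no longer
restrict the points `s = ½ + it` to a dyadic segment `T < t ≤ 2T`. The extension to the segment
`1 ≤ t ≤ T` can be now derived by adding the new inequalities (9.9) for sets of points in the
segments `2^ν ≤ t ≤ 2^{ν+1}` with `1 ≤ 2^ν ≤ T`."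

PROVED HERE (no named fact), in abstract form (`ConreyIwaniec2002.dyadic_union`): if a bound of the
shape of (9.12),
`Σ_{t ∈ S₀} f(t) ≤ C (A T₀/log T₀ + B T₀ log T₀ + (E/log T₀)(T₀ Σ_{t∈S₀} g(t))^{1/2})`,
holds for every dyadic sub-family `S₀ ⊂ (T₀, 2T₀]`, `T₀ ≥ 2`, of a `1`-spaced set `S ⊂ [2, T]`
(`0 ≤ f ≤ 1`, `g ≥ 0`, `A ≥ 1`, `B, E ≥ 0`), then it holds for `S` itself with `C′ = 8C + 1`.
Ingredients: `S ∩ (2, T] = ⋃_{1 ≤ ν ≤ N} S ∩ (2^ν, 2^{ν+1}]` with `2^N ≤ T < 2^{N+1}` (fibres of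
`t ↦ ⌈log t/log 2⌉ − 1`), the elementary dyadic sums `Σ_{ν≤N} 2^ν/ν ≤ 4·2^N/N`,
`Σ_{ν≤N} 2^ν ≤ 2^{N+1}`, `Σ_{ν≤N} 2^ν/ν² ≤ 6·2^N/N²`, Cauchy's inequality over `ν` for the last
term, and `#(S ∩ {2}) ≤ 1`.

## References

* [ConreyIwaniec2002] B. Conrey, H. Iwaniec, Acta Arith. 103 (2002) 259–312, arXiv:math/0111012:
  §9 (before Proposition 9.2).
-/

noncomputable section

namespace Literature.NumberTheory.LFunctions

namespace ConreyIwaniec2002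

/-! ### Elementary dyadic sums -/

/-- `Σ_{1 ≤ ν ≤ N} 2^ν/ν ≤ 4·2^N/N` for `N ≥ 1`. [folklore] -/
private theorem sum_two_pow_div_le {N : ℕ} (hN : 1 ≤ N) :
    ∑ ν ∈ Finset.Icc 1 N, (2 : ℝ) ^ ν / ν ≤ 4 * 2 ^ N / N := by
  rcases Nat.lt_or_ge N 2 with h | h
  · obtain rfl : N = 1 := by omega
    norm_num
  · induction N, h using Nat.le_induction with
    | base => norm_num [Finset.sum_Icc_succ_top]
    | succ n hn ih =>
      rw [Finset.sum_Icc_succ_top (by omega), pow_succ]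
      have hn0 : (0 : ℝ) < n := by exact_mod_cast (by omega : 0 < n)
      have hn2 : (2 : ℝ) ≤ n := by exact_mod_cast hn
      have h2n : (0 : ℝ) < 2 ^ n := by positivity
      have ih' := ih (by omega)
      push_cast
      calc ∑ k ∈ Finset.Icc 1 n, (2 : ℝ) ^ k / k + 2 ^ n * 2 / (n + 1)
          ≤ 4 * 2 ^ n / n + 2 ^ n * 2 / (n + 1) := by gcongr
        _ ≤ 4 * (2 ^ n * 2) / (n + 1) := by
          rw [div_add_div _ _ hn0.ne' (by positivity), div_le_div_iff₀ (by positivity) (by positivity)]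
          nlinarith [mul_pos h2n hn0, mul_pos (mul_pos h2n hn0) hn0]

/-- `Σ_{1 ≤ ν ≤ N} 2^ν ≤ 2^{N+1}`. [folklore] -/
private theorem sum_two_pow_le (N : ℕ) :
    ∑ ν ∈ Finset.Icc 1 N, (2 : ℝ) ^ ν ≤ 2 ^ (N + 1) := by
  induction N with
  | zero => simp
  | succ n ih =>
    rw [Finset.sum_Icc_succ_top (by omega)]
    have h1 : (2 : ℝ) ^ (n + 1 + 1) = 2 ^ (n + 1) * 2 := pow_succ 2 (n + 1)
    linarith [ih]

/-- `Σ_{1 ≤ ν ≤ N} 2^ν/ν² ≤ 6·2^N/N²` for `N ≥ 1`. [folklore] -/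
private theorem sum_two_pow_div_sq_le {N : ℕ} (hN : 1 ≤ N) :
    ∑ ν ∈ Finset.Icc 1 N, (2 : ℝ) ^ ν / (ν : ℝ) ^ 2 ≤ 6 * 2 ^ N / (N : ℝ) ^ 2 := by
  rcases Nat.lt_or_ge N 4 with h | h
  · interval_cases N <;> norm_num [Finset.sum_Icc_succ_top]
  · induction N, h using Nat.le_induction with
    | base => norm_num [Finset.sum_Icc_succ_top]
    | succ n hn ih =>
      rw [Finset.sum_Icc_succ_top (by omega), pow_succ]
      have hn0 : (0 : ℝ) < n := by exact_mod_cast (by omega : 0 < n)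
      have hn4 : (4 : ℝ) ≤ n := by exact_mod_cast hn
      have h2n : (0 : ℝ) < 2 ^ n := by positivity
      have ih' := ih (by omega)
      push_cast
      calc ∑ k ∈ Finset.Icc 1 n, (2 : ℝ) ^ k / (k : ℝ) ^ 2 + 2 ^ n * 2 / ((n : ℝ) + 1) ^ 2
          ≤ 6 * 2 ^ n / (n : ℝ) ^ 2 + 2 ^ n * 2 / ((n : ℝ) + 1) ^ 2 := by gcongr
        _ ≤ 6 * (2 ^ n * 2) / ((n : ℝ) + 1) ^ 2 := by
          rw [div_add_div _ _ (by positivity) (by positivity),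
            div_le_div_iff₀ (by positivity) (by positivity)]
          have hsq : (0 : ℝ) < (n : ℝ) ^ 2 := by positivity
          have hsq1 : (0 : ℝ) < ((n : ℝ) + 1) ^ 2 := by positivity
          -- `6(n+1)² ≤ 10 n²` for `n ≥ 4`
          have hkey : 6 * ((n : ℝ) + 1) ^ 2 ≤ 10 * (n : ℝ) ^ 2 := by nlinarith
          nlinarith [mul_pos h2n hsq, mul_pos h2n hsq1, mul_pos (mul_pos h2n hsq) hsq1,
            mul_le_mul_of_nonneg_left hkey (mul_pos h2n hsq1).le]

/-! ### Dyadic indices -/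

/-- The dyadic index `ν(t) = ⌈log t/log 2⌉ − 1` of `t > 1` satisfies `2^ν < t ≤ 2^{ν+1}`.
[folklore] -/
private theorem dyadic_index_mem {t : ℝ} (ht : 1 < t) :
    (2 : ℝ) ^ (⌈Real.log t / Real.log 2⌉₊ - 1) < t ∧
      t ≤ (2 : ℝ) ^ (⌈Real.log t / Real.log 2⌉₊ - 1 + 1) := by
  have hlog2 : 0 < Real.log 2 := Real.log_pos one_lt_two
  have ht0 : 0 < t := by linarith
  have hx0 : 0 < Real.log t / Real.log 2 := div_pos (Real.log_pos ht) hlog2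
  set k : ℕ := ⌈Real.log t / Real.log 2⌉₊ with hk
  have hk1 : 1 ≤ k := Nat.one_le_ceil_iff.mpr hx0
  have hkx : Real.log t / Real.log 2 ≤ k := Nat.le_ceil _
  have hkx' : (k : ℝ) < Real.log t / Real.log 2 + 1 := Nat.ceil_lt_add_one hx0.le
  have hcast : ((k - 1 : ℕ) : ℝ) = k - 1 := by rw [Nat.cast_sub hk1, Nat.cast_one]
  rw [Nat.sub_add_cancel hk1]
  constructor
  · rw [← Real.log_lt_log_iff (by positivity) ht0, Real.log_pow, hcast]
    have : ((k : ℝ) - 1) < Real.log t / Real.log 2 := by linarith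
    rwa [lt_div_iff₀ hlog2] at this
  · rw [← Real.log_le_log_iff ht0 (by positivity), Real.log_pow]
    rwa [div_le_iff₀ hlog2] at hkx

/-- For `t > 2` the dyadic index is at least `1`. [folklore] -/
private theorem one_le_dyadic_index {t : ℝ} (ht : 2 < t) :
    1 ≤ ⌈Real.log t / Real.log 2⌉₊ - 1 := by
  have hlog2 : 0 < Real.log 2 := Real.log_pos one_lt_two
  have hx1 : 1 < Real.log t / Real.log 2 := by
    rw [lt_div_iff₀ hlog2, one_mul]
    exact Real.log_lt_log two_pos ht
  have h2 : 2 ≤ ⌈Real.log t / Real.log 2⌉₊ := by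
    have := Nat.le_ceil (Real.log t / Real.log 2)
    have h : (1 : ℝ) < ⌈Real.log t / Real.log 2⌉₊ := lt_of_lt_of_le hx1 this
    have h' : 1 < ⌈Real.log t / Real.log 2⌉₊ := by exact_mod_cast h
    omega
  omega

/-- For `t ≤ T < 2^{N+1}` the dyadic index is at most `N`. [folklore] -/
private theorem dyadic_index_le {t T : ℝ} {N : ℕ} (ht : 1 < t) (htT : t ≤ T)
    (hT : T < (2 : ℝ) ^ (N + 1)) : ⌈Real.log t / Real.log 2⌉₊ - 1 ≤ N := by
  have h1 := (dyadic_index_mem ht).1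
  set ν := ⌈Real.log t / Real.log 2⌉₊ - 1
  have hlt : (2 : ℝ) ^ ν < 2 ^ (N + 1) := lt_of_lt_of_le h1 (htT.trans hT.le)
  have := (pow_lt_pow_iff_right₀ (one_lt_two : (1 : ℝ) < 2)).mp hlt
  omega

/-! ### The dyadic union -/

set_option maxHeartbeats 400000 in
/-- **The dyadic union of §9.** If a bound of the shape (9.12) holds, with one constant `C`, for
every dyadic sub-family `S₀ ⊂ (T₀, 2T₀]`, `T₀ ≥ 2`, of a `1`-spaced `S ⊂ [2, T]`, then it holds for
`S` with `C′ = 8C + 1` ("adding the new inequalities (9.9) for sets of points in the segments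
`2^ν ≤ t ≤ 2^{ν+1}` with `1 ≤ 2^ν ≤ T`"). [cite: ConreyIwaniec2002, §9 (before Proposition 9.2)] -/
theorem dyadic_union :
    ∀ C : ℝ, 0 < C → ∃ C' : ℝ, 0 < C' ∧
      ∀ (A B E T : ℝ) (S : Finset ℝ) (f g : ℝ → ℝ),
        1 ≤ A → 0 ≤ B → 0 ≤ E → 2 ≤ T → IsPointSet S T →
        (∀ t, 0 ≤ f t) → (∀ t, f t ≤ 1) → (∀ t, 0 ≤ g t) →
        (∀ (T₀ : ℝ) (S₀ : Finset ℝ), 2 ≤ T₀ → S₀ ⊆ S → IsDyadicPointSet S₀ T₀ →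
          ∑ t ∈ S₀, f t ≤
            C * (T₀ / Real.log T₀ * A + T₀ * Real.log T₀ * B +
              E / Real.log T₀ * Real.sqrt (T₀ * ∑ t ∈ S₀, g t))) →
        ∑ t ∈ S, f t ≤
          C' * (T / Real.log T * A + T * Real.log T * B +
            E / Real.log T * Real.sqrt (T * ∑ t ∈ S, g t)) := by
  classical
  intro C hC
  refine ⟨8 * C + 1, by positivity, fun A B E T S f g hA hB hE hT hS hf0 hf1 hg0 hseg => ?_⟩
  have hlog2 : 0 < Real.log 2 := Real.log_pos one_lt_two
  have hlog2' : Real.log 2 < 1 := by linarith [Real.log_two_lt_d9]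
  have hT0 : 0 < T := by linarith
  have hLT : 0 < Real.log T := Real.log_pos (by linarith)
  have hLT2 : Real.log 2 ≤ Real.log T := Real.log_le_log two_pos hT
  set G : ℝ := ∑ t ∈ S, g t with hGdef
  have hG0 : 0 ≤ G := Finset.sum_nonneg fun t _ => hg0 t
  -- the dyadic height `N`: `2^N ≤ T < 2^{N+1}`, `N ≥ 1`, `log T ≤ 2 N log 2`
  set N : ℕ := ⌊Real.log T / Real.log 2⌋₊ with hNdef
  have hx1 : 1 ≤ Real.log T / Real.log 2 := by rw [le_div_iff₀ hlog2, one_mul]; exact hLT2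
  have hN1 : 1 ≤ N := (Nat.le_floor_iff (by positivity)).mpr (by exact_mod_cast hx1)
  have hN0 : (0 : ℝ) < N := by exact_mod_cast hN1
  have hNle : (N : ℝ) ≤ Real.log T / Real.log 2 := Nat.floor_le (by positivity)
  have hNlt : Real.log T / Real.log 2 < N + 1 := Nat.lt_floor_add_one _
  have h2N : (2 : ℝ) ^ N ≤ T := by
    rw [← Real.log_le_log_iff (by positivity) hT0, Real.log_pow]
    rwa [le_div_iff₀ hlog2] at hNle
  have hT2N : T < (2 : ℝ) ^ (N + 1) := by
    rw [← Real.log_lt_log_iff hT0 (by positivity), Real.log_pow]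
    have := (div_lt_iff₀ hlog2).mp hNlt
    push_cast
    linarith
  have hNlog : (N : ℝ) * Real.log 2 ≤ Real.log T := (le_div_iff₀ hlog2).mp hNle
  have hlogN : Real.log T ≤ 2 * N * Real.log 2 := by
    rcases le_or_gt 2 (Real.log T / Real.log 2) with h | h
    · -- `N > x − 1 ≥ x/2`
      have : Real.log T / Real.log 2 ≤ 2 * N := by linarith
      rwa [div_le_iff₀ hlog2] at this
    · have h1 : Real.log T < 2 * Real.log 2 := by rwa [div_lt_iff₀ hlog2] at h
      have h2 : (1 : ℝ) ≤ N := by exact_mod_cast hN1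
      have h3 : 2 * Real.log 2 ≤ 2 * N * Real.log 2 := by nlinarith
      linarith
  -- the point `t = 2` (at most one point of `S`)
  have hS2 : ∑ t ∈ S.filter (fun t => t ≤ 2), f t ≤ 1 := by
    have hcard : (S.filter (fun t => t ≤ 2)).card ≤ 1 := by
      refine Finset.card_le_one_iff.mpr ?_
      intro a b ha hb
      rw [Finset.mem_filter] at ha hb
      linarith [hS.two_le ha.1, hS.two_le hb.1]
    calc ∑ t ∈ S.filter (fun t => t ≤ 2), f t ≤ ∑ t ∈ S.filter (fun t => t ≤ 2), (1 : ℝ) :=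
          Finset.sum_le_sum fun t _ => hf1 t
      _ = (S.filter (fun t => t ≤ 2)).card := by simp
      _ ≤ 1 := by exact_mod_cast hcard
  -- the rest, fibred by the dyadic index
  set S' : Finset ℝ := S.filter (fun t => ¬ t ≤ 2) with hS'def
  set idx : ℝ → ℕ := fun t => ⌈Real.log t / Real.log 2⌉₊ - 1 with hidx
  have hmaps : ∀ t ∈ S', idx t ∈ Finset.Icc 1 N := by
    intro t ht
    rw [hS'def, Finset.mem_filter, not_le] at ht
    rw [Finset.mem_Icc]
    exact ⟨one_le_dyadic_index ht.2, dyadic_index_le (by linarith) (hS.le ht.1) hT2N⟩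
  -- the fibres are dyadic point sets
  set F : ℕ → Finset ℝ := fun ν => S'.filter (fun t => idx t = ν) with hFdef
  have hFsub : ∀ ν, F ν ⊆ S := fun ν =>
    (Finset.filter_subset _ _).trans (Finset.filter_subset _ _)
  have hFdy : ∀ ν, IsDyadicPointSet (F ν) ((2 : ℝ) ^ ν) := by
    intro ν
    refine ⟨fun t ht => ?_, fun t ht u hu htu => hS.2 t (hFsub ν ht) u (hFsub ν hu) htu⟩
    rw [hFdef, Finset.mem_filter, hS'def, Finset.mem_filter, not_le] at ht
    obtain ⟨⟨-, ht2⟩, hν⟩ := ht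
    have h := dyadic_index_mem (show (1 : ℝ) < t by linarith)
    rw [show ⌈Real.log t / Real.log 2⌉₊ - 1 = ν from hν, pow_succ] at h
    exact ⟨h.1, by linarith [h.2]⟩
  -- per-fibre bound
  have hfib : ∀ ν ∈ Finset.Icc 1 N, ∑ t ∈ F ν, f t ≤
      C * ((2 : ℝ) ^ ν / (ν * Real.log 2) * A + (2 : ℝ) ^ ν * (ν * Real.log 2) * B +
        E / (ν * Real.log 2) * Real.sqrt ((2 : ℝ) ^ ν * ∑ t ∈ F ν, g t)) := by
    intro ν hν
    rw [Finset.mem_Icc] at hν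
    have h2ν : (2 : ℝ) ≤ (2 : ℝ) ^ ν := by
      calc (2 : ℝ) = 2 ^ 1 := (pow_one _).symm
        _ ≤ 2 ^ ν := pow_le_pow_right₀ one_le_two hν.1
    have h := hseg ((2 : ℝ) ^ ν) (F ν) h2ν (hFsub ν) (hFdy ν)
    rwa [Real.log_pow] at h
  -- sum of the fibres
  have hsumF : ∑ t ∈ S', f t = ∑ ν ∈ Finset.Icc 1 N, ∑ t ∈ F ν, f t :=
    (Finset.sum_fiberwise_of_maps_to hmaps f).symm
  have hsumG : ∑ ν ∈ Finset.Icc 1 N, ∑ t ∈ F ν, g t ≤ G := by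
    rw [Finset.sum_fiberwise_of_maps_to hmaps g, hGdef]
    exact Finset.sum_le_sum_of_subset_of_nonneg (Finset.filter_subset _ _) fun t _ _ => hg0 t
  -- the three dyadic sums
  have hsumA : ∑ ν ∈ Finset.Icc 1 N, (2 : ℝ) ^ ν / (ν * Real.log 2) ≤ 8 * (T / Real.log T) := by
    have h1 : ∑ ν ∈ Finset.Icc 1 N, (2 : ℝ) ^ ν / (ν * Real.log 2) =
        (∑ ν ∈ Finset.Icc 1 N, (2 : ℝ) ^ ν / ν) / Real.log 2 := by
      rw [Finset.sum_div]
      refine Finset.sum_congr rfl fun ν _ => ?_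
      rw [div_div]
    rw [h1, div_le_iff₀ hlog2]
    refine (sum_two_pow_div_le hN1).trans ?_
    -- `4·2^N/N ≤ 8 (T/log T) log 2` since `2^N ≤ T` and `log T ≤ 2N log 2`
    rw [div_le_iff₀ hN0]
    calc 4 * (2 : ℝ) ^ N ≤ 4 * T := by linarith
      _ = 4 * (T / Real.log T) * Real.log T := by field_simp
      _ ≤ 4 * (T / Real.log T) * (2 * N * Real.log 2) := by gcongr
      _ = 8 * (T / Real.log T) * Real.log 2 * N := by ring
  have hsumB : ∑ ν ∈ Finset.Icc 1 N, (2 : ℝ) ^ ν * (ν * Real.log 2) ≤ 2 * (T * Real.log T) := by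
    calc ∑ ν ∈ Finset.Icc 1 N, (2 : ℝ) ^ ν * (ν * Real.log 2)
        ≤ ∑ ν ∈ Finset.Icc 1 N, (2 : ℝ) ^ ν * (N * Real.log 2) := by
          refine Finset.sum_le_sum fun ν hν => ?_
          rw [Finset.mem_Icc] at hν
          have : (ν : ℝ) ≤ N := by exact_mod_cast hν.2
          gcongr
      _ = (∑ ν ∈ Finset.Icc 1 N, (2 : ℝ) ^ ν) * (N * Real.log 2) := by rw [Finset.sum_mul]
      _ ≤ (2 : ℝ) ^ (N + 1) * (N * Real.log 2) := by gcongr; exact sum_two_pow_le N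
      _ = 2 * (2 ^ N * (N * Real.log 2)) := by ring
      _ ≤ 2 * (T * Real.log T) := by gcongr
  have hsumE : ∑ ν ∈ Finset.Icc 1 N, E / (ν * Real.log 2) * Real.sqrt ((2 : ℝ) ^ ν * ∑ t ∈ F ν, g t)
      ≤ 5 * (E / Real.log T * Real.sqrt (T * G)) := by
    -- Cauchy's inequality over `ν`
    have hcs := Finset.sum_mul_sq_le_sq_mul_sq (Finset.Icc 1 N)
      (fun ν => Real.sqrt ((2 : ℝ) ^ ν) / ν) (fun ν => Real.sqrt (∑ t ∈ F ν, g t))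
    have hrew : ∑ ν ∈ Finset.Icc 1 N, E / (ν * Real.log 2) * Real.sqrt ((2 : ℝ) ^ ν * ∑ t ∈ F ν, g t)
        = E / Real.log 2 * ∑ ν ∈ Finset.Icc 1 N,
            Real.sqrt ((2 : ℝ) ^ ν) / ν * Real.sqrt (∑ t ∈ F ν, g t) := by
      rw [Finset.mul_sum]
      refine Finset.sum_congr rfl fun ν hν => ?_
      rw [Finset.mem_Icc] at hν
      have hν0 : (0 : ℝ) < ν := by exact_mod_cast hν.1
      rw [Real.sqrt_mul (by positivity)]
      field_simp
    have ha2 : ∑ ν ∈ Finset.Icc 1 N, (Real.sqrt ((2 : ℝ) ^ ν) / ν) ^ 2 ≤ 6 * 2 ^ N / (N : ℝ) ^ 2 := by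
      refine le_trans (le_of_eq (Finset.sum_congr rfl fun ν _ => ?_)) (sum_two_pow_div_sq_le hN1)
      rw [div_pow, Real.sq_sqrt (by positivity)]
    have hb2 : ∑ ν ∈ Finset.Icc 1 N, (Real.sqrt (∑ t ∈ F ν, g t)) ^ 2 ≤ G := by
      refine le_trans (le_of_eq (Finset.sum_congr rfl fun ν _ => ?_)) hsumG
      rw [Real.sq_sqrt (Finset.sum_nonneg fun t _ => hg0 t)]
    have hinner : ∑ ν ∈ Finset.Icc 1 N, Real.sqrt ((2 : ℝ) ^ ν) / ν * Real.sqrt (∑ t ∈ F ν, g t) ≤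
        Real.sqrt (6 * 2 ^ N / (N : ℝ) ^ 2) * Real.sqrt G := by
      have h1 := (le_abs_self _).trans (Real.abs_le_sqrt hcs)
      rw [Real.sqrt_mul (Finset.sum_nonneg fun _ _ => by positivity)] at h1
      refine h1.trans ?_
      gcongr
    -- `√(6·2^N/N²) ≤ √6 √T / N ≤ 2√6 (log 2) √T / log T`
    have hsq : Real.sqrt (6 * 2 ^ N / (N : ℝ) ^ 2) ≤ Real.sqrt 6 * Real.sqrt T / N := by
      rw [Real.sqrt_div (by positivity), Real.sqrt_sq hN0.le, Real.sqrt_mul (by norm_num)]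
      gcongr
    have hsqrt6 : Real.sqrt 6 ≤ 5 / 2 := by
      rw [Real.sqrt_le_left (by norm_num)]; norm_num
    rw [hrew]
    have hE2 : 0 ≤ E / Real.log 2 := by positivity
    calc E / Real.log 2 * ∑ ν ∈ Finset.Icc 1 N, Real.sqrt ((2 : ℝ) ^ ν) / ν * Real.sqrt (∑ t ∈ F ν, g t)
        ≤ E / Real.log 2 * (Real.sqrt 6 * Real.sqrt T / N * Real.sqrt G) := by
          gcongr
          exact hinner.trans (by gcongr)
      _ = E * Real.sqrt 6 * (Real.sqrt T * Real.sqrt G) / (N * Real.log 2) := by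
          field_simp
      _ ≤ E * Real.sqrt 6 * (Real.sqrt T * Real.sqrt G) / (Real.log T / 2) :=
          div_le_div_of_nonneg_left (by positivity) (by positivity) (by linarith)
      _ = 2 * Real.sqrt 6 * (E / Real.log T * Real.sqrt (T * G)) := by
          rw [Real.sqrt_mul hT0.le]; field_simp
      _ ≤ 5 * (E / Real.log T * Real.sqrt (T * G)) := by
          have : 0 ≤ E / Real.log T * Real.sqrt (T * G) := by positivity
          nlinarith
  -- assemble
  have hsplit : ∑ t ∈ S, f t = ∑ t ∈ S.filter (fun t => t ≤ 2), f t + ∑ t ∈ S', f t :=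
    (Finset.sum_filter_add_sum_filter_not S (fun t => t ≤ 2) f).symm
  have hmain : ∑ t ∈ S', f t ≤ C * (8 * (T / Real.log T) * A + 2 * (T * Real.log T) * B +
      5 * (E / Real.log T * Real.sqrt (T * G))) := by
    rw [hsumF]
    calc ∑ ν ∈ Finset.Icc 1 N, ∑ t ∈ F ν, f t
        ≤ ∑ ν ∈ Finset.Icc 1 N, C * ((2 : ℝ) ^ ν / (ν * Real.log 2) * A +
            (2 : ℝ) ^ ν * (ν * Real.log 2) * B +
            E / (ν * Real.log 2) * Real.sqrt ((2 : ℝ) ^ ν * ∑ t ∈ F ν, g t)) := Finset.sum_le_sum hfib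
      _ = C * ((∑ ν ∈ Finset.Icc 1 N, (2 : ℝ) ^ ν / (ν * Real.log 2)) * A +
            (∑ ν ∈ Finset.Icc 1 N, (2 : ℝ) ^ ν * (ν * Real.log 2)) * B +
            ∑ ν ∈ Finset.Icc 1 N, E / (ν * Real.log 2) *
              Real.sqrt ((2 : ℝ) ^ ν * ∑ t ∈ F ν, g t)) := by
          rw [← Finset.mul_sum, Finset.sum_add_distrib, Finset.sum_add_distrib, Finset.sum_mul,
            Finset.sum_mul]
      _ ≤ C * (8 * (T / Real.log T) * A + 2 * (T * Real.log T) * B +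
            5 * (E / Real.log T * Real.sqrt (T * G))) := by
          gcongr
  -- `1 ≤ (T / log T) A`
  have hpt : (1 : ℝ) ≤ T / Real.log T * A := by
    have h1 : Real.log T ≤ T := (Real.log_le_sub_one_of_pos hT0).trans (by linarith)
    have h2 : 1 ≤ T / Real.log T := by rw [le_div_iff₀ hLT]; linarith
    nlinarith
  have hX1 : 0 ≤ T / Real.log T * A := by positivity
  have hX2 : 0 ≤ T * Real.log T * B := by positivity
  have hX3 : 0 ≤ E / Real.log T * Real.sqrt (T * G) := by positivity
  rw [hsplit]
  calc ∑ t ∈ S.filter (fun t => t ≤ 2), f t + ∑ t ∈ S', f t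
      ≤ 1 + C * (8 * (T / Real.log T) * A + 2 * (T * Real.log T) * B +
          5 * (E / Real.log T * Real.sqrt (T * G))) := add_le_add hS2 hmain
    _ ≤ (8 * C + 1) * (T / Real.log T * A + T * Real.log T * B +
          E / Real.log T * Real.sqrt (T * G)) := by
        nlinarith [mul_nonneg hC.le hX2, mul_nonneg hC.le hX3, mul_nonneg hC.le hX1]

end ConreyIwaniec2002

end Literature.NumberTheory.LFunctions

end
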